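import Mathlib
import HarnessLib
import Summits.RiemannHypothesis.RiemannHypothesis.Theorems.IntegerScrewRungCertSeries

/-!
# Route `IntegerScrew` — kernel certificate checker for the finite rungs: the Hurwitz–Lerch piece in direct `ℕ` arithmetic

The entry enclosures `u(a,b) ∋ Ψ(log(a/b)) − ζ(2,¼)/4` of the rung checkers (`IntegerScrewRungCertDefs`, `…Fast`,
`…Wide`) spend most of their kernel time in the series `Φ(x) = Σ_k x^k/(k+¼)² = Σ_k 16x^k/(4k+1)²` at `x = b²/a²`
(`lerchGoK`: one `FI.mul`, one `FI.mulInt`, one `FI.divNat`, one `FI.add` per term — `≈ 1.3 ms` of kernel time per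
term on the gate farm, `≈ 1.4·10⁵` terms at `N = 127`, `≈ 10⁶` at `N = 255`).  Measured on the farm (this seat,
2026-08-25): an interval (`FI`) operation pair costs `≈ 0.77 ms`, an `Int` operation through notation `≈ 95 µs`, a DIRECT
`Nat.mul / Nat.div / Nat.add` with a `cond (Nat.blt …)` guard `≈ 7 µs`.  This file re-implements the loop as a plain
fixed-point recurrence on natural numbers at the engine's scale `SC = 2^48`,

  `p₀ = SC`, `p_{k+1} = ⌊p_k·b²/a²⌋`, `t_k = ⌊16 p_k/(4k+1)²⌋`, `s_{k+1} = s_k + t_k`,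

with the rounding analysed ONCE (`lerchGoN_spec`): `p_k ≤ SC·x^k ≤ p_k + k` and `s_k ≤ SC·Σ_{i<k} 16x^i/(4i+1)² ≤ s_k + 2k`
(each floor loses `< 1`; `16k ≤ (4k+1)²`), and the tail added by the tree's bound `Σ_{j≥K} ≤ x^K/((K+¼)²(1−x))`
(`tail_le_lerchTail` of `…Series`): ★ `mem_lerchEnclN : Φ(b²/a²) ∈ lerchEnclN a b K` for every `K` (`b < a`) — a drop-in
replacement for `lerchEnclK a b K` in the table functions (`≈ 9` kernel primitives per term instead of `≈ 15` `Int`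
operations inside interval records).  Nothing here bears on the truth of RH (every rung is an RH-consequence made
unconditional by computation).  References: S. M. Rump, Acta Numerica 19 (2010) §10.8 (fixed-point/interval evaluation with
a-priori rounding budgets) [folklore]; M. Suzuki, J. Lond. Math. Soc. (2) 108 (2023), (1.1) [Suzuki2023].
-/

set_option linter.dupNamespace false
set_option autoImplicit false

namespace Summit.RiemannHypothesis.RiemannHypothesis.Theorems.IntegerScrew.RungCert

open Literature.NumberTheory.LFunctions Literature.Analysis.ValidatedNumerics Finset
open Literature.Analysis.ValidatedNumerics.Numerics
open scoped BigOperators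

/-! ## The loop (direct `ℕ` primitives; the `cond` guard forces the state at every step) -/

/-- The guard bound `20·2^48 > SC·ζ(2,¼)` (never reached; it only forces evaluation). [folklore] -/
def lerchBnd : ℕ := 20 * SC

/-- `K` steps of the fixed-point recurrence from the state `(k, p, s)`:
`p ← ⌊p·xn/xd⌋`, `s ← s + ⌊16p/(4k+1)²⌋`, `k ← k+1`. [folklore] -/
def lerchGoN (xn xd : ℕ) : ℕ → ℕ → ℕ → ℕ → ℕ × ℕ × ℕ
  | 0, k, p, s => (k, p, s)
  | K + 1, k, p, s =>
      cond (Nat.blt lerchBnd s) (k, p, s)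
        (lerchGoN xn xd K (k + 1) (Nat.div (Nat.mul p xn) xd)
          (Nat.add s (Nat.div (Nat.mul p 16) (Nat.mul (4 * k + 1) (4 * k + 1)))))

/-- **Enclosure of `Φ(b²/a²) = Σ_k (b²/a²)^k/(k+¼)²`** from `K` fixed-point terms: lower end the floor sum, upper end
`+ 2K` ulps `+` the geometric tail bound of the tree (`lerchTail`). [folklore] -/
def lerchEnclN (a b K : ℕ) : FI :=
  let xn := b * b
  let xd := a * a
  let r := lerchGoN xn xd K 0 SC 0
  ⟨(r.2.2 : ℤ), (r.2.2 : ℤ) + 2 * (r.1 : ℤ) + (lerchTail xn xd r.1 ⟨(r.2.1 : ℤ), (r.2.1 : ℤ) + r.1⟩).hi⟩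

/-! ## Rounding analysis -/

/-- The recurrence step in notation. [folklore] -/
theorem lerchGoN_succ (xn xd K k p s : ℕ) :
    lerchGoN xn xd (K + 1) k p s =
      cond (Nat.blt lerchBnd s) (k, p, s)
        (lerchGoN xn xd K (k + 1) (p * xn / xd) (s + p * 16 / ((4 * k + 1) * (4 * k + 1)))) := rfl

/-- Floor division from below: `m/n − 1 < ⌊m/n⌋`. [folklore] -/
theorem div_sub_one_lt_natDiv (m : ℕ) {n : ℕ} (hn : 0 < n) : (m : ℝ) / n - 1 < ((m / n : ℕ) : ℝ) := by
  have h := Nat.lt_div_mul_add (a := m) hn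
  have hn' : (0 : ℝ) < n := by exact_mod_cast hn
  have h' : (m : ℝ) < ((m / n : ℕ) : ℝ) * n + n := by exact_mod_cast h
  rw [sub_lt_iff_lt_add, div_lt_iff₀ hn']
  linarith

/-- `16k ≤ (4k+1)²`. [folklore] -/
theorem sixteen_mul_le_sq (k : ℕ) : (16 : ℝ) * k ≤ ((4 * k + 1 : ℕ) : ℝ) * ((4 * k + 1 : ℕ) : ℝ) := by
  have : (16 : ℝ) * k ≤ (4 * k + 1) * (4 * k + 1) := by nlinarith [sq_nonneg ((4 : ℝ) * k - 1)]
  simpa using this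

/-- The partial sums `S_k(x) = Σ_{i<k} x^i/(i+¼)²`. [folklore] -/
noncomputable def lerchPartial (x : ℝ) (k : ℕ) : ℝ := ∑ i ∈ range k, x ^ i / ((i : ℝ) + 1 / 4) ^ 2

/-- `x^i/(i+¼)² = 16x^i/(4i+1)²`. [folklore] -/
theorem term_eq_sixteen (x : ℝ) (i : ℕ) :
    x ^ i / ((i : ℝ) + 1 / 4) ^ 2 = 16 * x ^ i / (((4 * i + 1 : ℕ) : ℝ) * ((4 * i + 1 : ℕ) : ℝ)) := by
  have h : ((i : ℝ) + 1 / 4) ^ 2 = ((4 * i + 1 : ℕ) : ℝ) * ((4 * i + 1 : ℕ) : ℝ) / 16 := by push_cast; ring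
  rw [h, div_div_eq_mul_div]
  ring

/-- **The rounding invariant of the loop**: from `p ≤ SC·x^k ≤ p + k` and `s ≤ SC·S_k ≤ s + 2k` the same holds at the
returned state `(k', p', s')`. [folklore] -/
theorem lerchGoN_spec {xn xd : ℕ} (hxd : 0 < xd) (hle : xn ≤ xd) :
    ∀ (K k p s : ℕ),
      (p : ℝ) ≤ SC * ((xn : ℝ) / xd) ^ k → SC * ((xn : ℝ) / xd) ^ k ≤ p + k →
      (s : ℝ) ≤ SC * lerchPartial ((xn : ℝ) / xd) k → SC * lerchPartial ((xn : ℝ) / xd) k ≤ s + 2 * k →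
      let r := lerchGoN xn xd K k p s
      (r.2.1 : ℝ) ≤ SC * ((xn : ℝ) / xd) ^ r.1 ∧ SC * ((xn : ℝ) / xd) ^ r.1 ≤ r.2.1 + r.1 ∧
        (r.2.2 : ℝ) ≤ SC * lerchPartial ((xn : ℝ) / xd) r.1 ∧ SC * lerchPartial ((xn : ℝ) / xd) r.1 ≤ r.2.2 + 2 * r.1
  | 0, k, p, s, h1, h2, h3, h4 => ⟨h1, h2, h3, h4⟩
  | K + 1, k, p, s, h1, h2, h3, h4 => by
      rw [lerchGoN_succ]
      cases Nat.blt lerchBnd s with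
      | true => exact ⟨h1, h2, h3, h4⟩
      | false =>
        simp only [cond_false]
        set x : ℝ := (xn : ℝ) / xd with hx
        have hxd' : (0 : ℝ) < xd := by exact_mod_cast hxd
        have hx0 : 0 ≤ x := by positivity
        have hx1 : x ≤ 1 := by rw [hx, div_le_one hxd']; exact_mod_cast hle
        have hxk : 0 ≤ x ^ k := pow_nonneg hx0 k
        set q : ℕ := (4 * k + 1) * (4 * k + 1) with hq
        have hq0 : 0 < q := by positivity
        have hqR : (q : ℝ) = ((4 * k + 1 : ℕ) : ℝ) * ((4 * k + 1 : ℕ) : ℝ) := by rw [hq]; push_cast; ring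
        have hqpos : (0 : ℝ) < q := by exact_mod_cast hq0
        -- the new power
        have hp'le : (((p * xn / xd : ℕ)) : ℝ) ≤ SC * x ^ (k + 1) := by
          calc (((p * xn / xd : ℕ)) : ℝ) ≤ ((p * xn : ℕ) : ℝ) / xd := Nat.cast_div_le
            _ = (p : ℝ) * x := by rw [hx]; push_cast; ring
            _ ≤ SC * x ^ k * x := mul_le_mul_of_nonneg_right h1 hx0
            _ = SC * x ^ (k + 1) := by ring
        have hp'ge : SC * x ^ (k + 1) ≤ (((p * xn / xd : ℕ)) : ℝ) + ((k + 1 : ℕ) : ℝ) := by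
          have hfl := div_sub_one_lt_natDiv (p * xn) hxd
          have e : ((p * xn : ℕ) : ℝ) / xd = (p : ℝ) * x := by rw [hx]; push_cast; ring
          rw [e] at hfl
          have hkx : (k : ℝ) * x ≤ k := by nlinarith [hx1, (Nat.cast_nonneg k : (0 : ℝ) ≤ k)]
          calc SC * x ^ (k + 1) = SC * x ^ k * x := by ring
            _ ≤ ((p : ℝ) + k) * x := mul_le_mul_of_nonneg_right h2 hx0
            _ = (p : ℝ) * x + k * x := by ring
            _ ≤ ((((p * xn / xd : ℕ)) : ℝ) + 1) + k := by linarith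
            _ = (((p * xn / xd : ℕ)) : ℝ) + ((k + 1 : ℕ) : ℝ) := by push_cast; ring
        -- the new partial sum
        have hS : lerchPartial x (k + 1) = lerchPartial x k + 16 * x ^ k / q := by
          rw [lerchPartial, Finset.sum_range_succ, ← lerchPartial, term_eq_sixteen, hqR]
        have ht_le : (((p * 16 / q : ℕ)) : ℝ) ≤ SC * (16 * x ^ k / q) := by
          calc (((p * 16 / q : ℕ)) : ℝ) ≤ ((p * 16 : ℕ) : ℝ) / q := Nat.cast_div_le
            _ = (p : ℝ) * 16 / q := by push_cast; ring
            _ ≤ SC * x ^ k * 16 / q := by gcongr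
            _ = SC * (16 * x ^ k / q) := by ring
        have ht_ge : SC * (16 * x ^ k / q) ≤ (((p * 16 / q : ℕ)) : ℝ) + 2 := by
          have hfl := div_sub_one_lt_natDiv (p * 16) hq0
          have e : ((p * 16 : ℕ) : ℝ) / q = (p : ℝ) * 16 / q := by push_cast; ring
          rw [e] at hfl
          have h16 : (16 : ℝ) * k / q ≤ 1 := by
            rw [div_le_one hqpos, hqR]; exact sixteen_mul_le_sq k
          calc SC * (16 * x ^ k / q) = SC * x ^ k * 16 / q := by ring
            _ ≤ ((p : ℝ) + k) * 16 / q := by gcongr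
            _ = (p : ℝ) * 16 / q + 16 * k / q := by ring
            _ ≤ ((((p * 16 / q : ℕ)) : ℝ) + 1) + 1 := by linarith
            _ = (((p * 16 / q : ℕ)) : ℝ) + 2 := by ring
        have h3' : (((s + p * 16 / q : ℕ)) : ℝ) ≤ SC * lerchPartial x (k + 1) := by
          rw [hS, mul_add]; push_cast; linarith
        have h4' : SC * lerchPartial x (k + 1) ≤ (((s + p * 16 / q : ℕ)) : ℝ) + 2 * ((k + 1 : ℕ) : ℝ) := by
          rw [hS, mul_add]; push_cast; linarith
        exact lerchGoN_spec hxd hle K (k + 1) _ _ hp'le hp'ge h3' h4'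

/-- ★ **`Φ(b²/a²) ∈ lerchEnclN a b K`** for every `K` (`b < a`). [folklore] -/
theorem mem_lerchEnclN {a b : ℕ} (hab : b < a) (K : ℕ) :
    FI.mem (∑' k : ℕ, (((b * b : ℕ) : ℝ) / ((a * a : ℕ) : ℝ)) ^ k / ((k : ℝ) + 1 / 4) ^ 2)
      (lerchEnclN a b K) := by
  have ha : 0 < a := by omega
  have hlt : b * b < a * a := Nat.mul_self_lt_mul_self hab
  have hxd : 0 < a * a := Nat.mul_pos ha ha
  set x : ℝ := ((b * b : ℕ) : ℝ) / ((a * a : ℕ) : ℝ) with hxdef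
  have hxd' : (0 : ℝ) < ((a * a : ℕ) : ℝ) := by exact_mod_cast hxd
  have hx0 : 0 ≤ x := by positivity
  have hx1 : x < 1 := by rw [hxdef, div_lt_one hxd']; exact_mod_cast hlt
  -- the loop invariant from the initial state `(0, SC, 0)`
  have h1 : ((SC : ℕ) : ℝ) ≤ SC * x ^ 0 := by simp
  have h2 : SC * x ^ 0 ≤ ((SC : ℕ) : ℝ) + ((0 : ℕ) : ℝ) := by simp
  have h3 : ((0 : ℕ) : ℝ) ≤ SC * lerchPartial x 0 := by simp [lerchPartial]
  have h4 : SC * lerchPartial x 0 ≤ ((0 : ℕ) : ℝ) + 2 * ((0 : ℕ) : ℝ) := by simp [lerchPartial]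
  obtain ⟨hp1, hp2, hs1, hs2⟩ := lerchGoN_spec hxd hlt.le K 0 SC 0 h1 h2 h3 h4
  set r := lerchGoN (b * b) (a * a) K 0 SC 0 with hr
  rw [← hxdef] at hp1 hp2 hs1 hs2
  -- split the series at `r.1`
  have hsum := summable_lerch hx0 hx1.le
  have hsplit := (hsum.sum_add_tsum_nat_add r.1).symm
  have htail0 : 0 ≤ ∑' i : ℕ, x ^ (i + r.1) / (((i + r.1 : ℕ) : ℝ) + 1 / 4) ^ 2 :=
    tsum_nonneg fun i => by positivity
  have hpw : FI.mem ((((b * b : ℕ) : ℝ) / ((a * a : ℕ) : ℝ)) ^ r.1) ⟨(r.2.1 : ℤ), (r.2.1 : ℤ) + r.1⟩ := by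
    rw [← hxdef]
    constructor
    · push_cast; linarith
    · push_cast; linarith
  have htail := tail_le_lerchTail hlt hpw
  rw [← hxdef] at htail
  have hpart : lerchPartial x r.1 = ∑ i ∈ range r.1, x ^ i / ((i : ℝ) + 1 / 4) ^ 2 := rfl
  have hSC := SC_pos
  simp only [lerchEnclN]
  rw [← hr]
  refine ⟨?_, ?_⟩
  · push_cast
    rw [hsplit, add_mul, ← hpart]
    nlinarith [hs1, mul_nonneg htail0 SC_pos.le]
  · push_cast
    rw [hsplit, add_mul, ← hpart]
    nlinarith [hs2, htail]

end Summit.RiemannHypothesis.RiemannHypothesis.Theorems.IntegerScrew.RungCert
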